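import Mathlib
import Summits.NavierStokesRegularity.NavierStokesRegularity.Theorems.ScenarioCensusPitchDefectColumnarPotential
import HarnessLib

/-!
# Census row A8t, line «pitch-defect»: columnar fields pair to zero with solenoidal fields (S3a2, part 2b)

Support file for the scenario census of `NavierStokesRegularity` (row A8t, line «pitch-defect»,
stub S3a2 «columnar swirl–axial fields are Oseen-invisible»; KEY-NS #101 (2)).

`Columnar.integral_inner_fderiv_apply_eq_zero` — **the slice identity**: for a columnar field `Z`
(C¹, bounded with bounded derivative, divergence free, `x₃`-independent, rotation-equivariant) and
every `C¹` divergence-free field `ψ` with `(1 + ‖y‖)⁵ (‖ψ(y)‖ + ‖Dψ(y)‖)` bounded,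
`∫ ⟪Z(y), Dψ(y)[Z(y)]⟫ dy = 0`. Two integrations by parts on `ℝ³`
(`integral_bilinear_hasFDerivAt_right_eq_neg_left_of_integrable`):
`∫ ⟪Z⊗Z, ∇ψ⟫ = −∫ ⟪(div Z) Z + DZ[Z], ψ⟫ = −∫ ⟪DZ[Z], ψ⟫ = ∫ DΦ[ψ] = −∫ Φ div ψ = 0`, with the
radial potential `Φ` of `ScenarioCensusPitchDefectColumnarPotential.lean`. This is the weak form,
against the non-compactly-supported caloric test fields of the Oseen–Duhamel pairing, of «the
nonlinearity of a columnar flow is a pressure gradient». No summit statement and no census row is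
proved here.
-/

-- the summit and its single problem share the name (D-0017 nested layout)
set_option linter.dupNamespace false

noncomputable section

open MeasureTheory Set Function Filter Metric intervalIntegral
open scoped Topology ENNReal NNReal RealInnerProductSpace

namespace Summit.NavierStokesRegularity.NavierStokesRegularity.Theorems.ScenarioCensus.PitchDefect

open Literature.Analysis Literature.Analysis.FluidPDE

namespace Columnar

variable {Z : EuclideanSpace ℝ (Fin 3) → EuclideanSpace ℝ (Fin 3)}

/-! ### Two integrations by parts -/

/-- Integrability from polynomial decay of order `4 > 3 = dim`. [folklore] -/
theorem integrable_of_decay_four {F' : Type*} [NormedAddCommGroup F'] [NormedSpace ℝ F']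
    {f : EuclideanSpace ℝ (Fin 3) → F'} (hf : Continuous f) {C : ℝ}
    (h : ∀ y, (1 + ‖y‖) ^ 4 * ‖f y‖ ≤ C) : Integrable f := by
  have hI : Integrable (fun y : EuclideanSpace ℝ (Fin 3) => (1 + ‖y‖) ^ (-(4 : ℝ))) volume :=
    integrable_one_add_norm (by rw [finrank_euclideanSpace_fin]; norm_num)
  refine (hI.const_mul C).mono' hf.aestronglyMeasurable (Eventually.of_forall fun y => ?_)
  have hp : 0 < (1 + ‖y‖) ^ 4 := by positivity
  rw [Real.rpow_neg (by positivity), show (4 : ℝ) = ((4 : ℕ) : ℝ) by norm_num, Real.rpow_natCast,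
    ← div_eq_mul_inv, le_div_iff₀ hp, mul_comm]
  exact h y

/-- **The slice identity: a columnar field pairs to zero with the gradient of every solenoidal,
rapidly decaying field along itself**: `∫ ⟪Z(y), Dψ(y)[Z(y)]⟫ dy = 0` (see the module
docstring). [cite: MajdaBertozzi2002, §2.2.1 Example 2.1 (the self-interaction of a radial eddy is a pressure gradient)] -/
theorem integral_inner_fderiv_apply_eq_zero {M L K : ℝ} (hZ : ContDiff ℝ 1 Z) (hM : ∀ y, ‖Z y‖ ≤ M)
    (hL : ∀ y, ‖fderiv ℝ Z y‖ ≤ L) (hdiv : VectorCalculus.IsDivFree Z)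
    (hz : ∀ (s : ℝ) (y : EuclideanSpace ℝ (Fin 3)), Z (y + s • EuclideanSpace.single 2 (1 : ℝ)) = Z y)
    (hrot : ∀ (θ : ℝ) (y : EuclideanSpace ℝ (Fin 3)), Z (rotZ θ y) = rotZ θ (Z y))
    {ψ : EuclideanSpace ℝ (Fin 3) → EuclideanSpace ℝ (Fin 3)} (hψ : ContDiff ℝ 1 ψ)
    (hψdiv : VectorCalculus.IsDivFree ψ)
    (hψK : ∀ y, (1 + ‖y‖) ^ 5 * ‖ψ y‖ ≤ K) (hDψK : ∀ y, (1 + ‖y‖) ^ 5 * ‖fderiv ℝ ψ y‖ ≤ K) :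
    ∫ y, ⟪Z y, fderiv ℝ ψ y (Z y)⟫ = 0 := by
  have eq_sum_single : ∀ v : EuclideanSpace ℝ (Fin 3),
      v = (v 0) • EuclideanSpace.single 0 (1 : ℝ) + (v 1) • EuclideanSpace.single 1 (1 : ℝ) +
        (v 2) • EuclideanSpace.single 2 (1 : ℝ) := fun v => by
    ext i; fin_cases i <;> simp
  have hZd : Differentiable ℝ Z := hZ.differentiable (by simp)
  have hZc : Continuous Z := hZ.continuous
  have hDZc : Continuous (fderiv ℝ Z) := hZ.continuous_fderiv (by simp)
  have hψd : Differentiable ℝ ψ := hψ.differentiable (by simp)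
  have hψc : Continuous ψ := hψ.continuous
  have hDψc : Continuous (fderiv ℝ ψ) := hψ.continuous_fderiv (by simp)
  have hM0 : 0 ≤ M := (norm_nonneg _).trans (hM 0)
  have hL0 : 0 ≤ L := (norm_nonneg _).trans (hL 0)
  have hK0 : 0 ≤ K := le_trans (by positivity) (hψK 0)
  obtain ⟨Φ, hΦ, hΦb⟩ := exists_potential hZ hM hL hdiv hz hrot
  have hΦc : Continuous Φ := continuous_iff_continuousAt.2 fun y => (hΦ y).continuousAt
  -- ## decay bookkeeping: weaker forms of the hypotheses
  have hone : ∀ y : EuclideanSpace ℝ (Fin 3), 1 ≤ 1 + ‖y‖ := fun y => by linarith [norm_nonneg y]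
  have h45 : ∀ y : EuclideanSpace ℝ (Fin 3), (1 + ‖y‖) ^ 4 ≤ (1 + ‖y‖) ^ 5 := fun y =>
    pow_le_pow_right₀ (hone y) (by norm_num)
  have hψ4 : ∀ y, (1 + ‖y‖) ^ 4 * ‖ψ y‖ ≤ K := fun y =>
    (mul_le_mul_of_nonneg_right (h45 y) (norm_nonneg _)).trans (hψK y)
  have hDψ4 : ∀ y, (1 + ‖y‖) ^ 4 * ‖fderiv ℝ ψ y‖ ≤ K := fun y =>
    (mul_le_mul_of_nonneg_right (h45 y) (norm_nonneg _)).trans (hDψK y)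
  have hyDψ4 : ∀ y, (1 + ‖y‖) ^ 4 * (‖y‖ * ‖fderiv ℝ ψ y‖) ≤ K := fun y => by
    calc (1 + ‖y‖) ^ 4 * (‖y‖ * ‖fderiv ℝ ψ y‖) ≤ (1 + ‖y‖) ^ 4 * ((1 + ‖y‖) * ‖fderiv ℝ ψ y‖) := by
          gcongr; linarith [norm_nonneg y]
      _ = (1 + ‖y‖) ^ 5 * ‖fderiv ℝ ψ y‖ := by ring
      _ ≤ K := hDψK y
  have hyψ4 : ∀ y, (1 + ‖y‖) ^ 4 * (‖y‖ * ‖ψ y‖) ≤ K := fun y => by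
    calc (1 + ‖y‖) ^ 4 * (‖y‖ * ‖ψ y‖) ≤ (1 + ‖y‖) ^ 4 * ((1 + ‖y‖) * ‖ψ y‖) := by
          gcongr; linarith [norm_nonneg y]
      _ = (1 + ‖y‖) ^ 5 * ‖ψ y‖ := by ring
      _ ≤ K := hψK y
  -- the frame
  set e : Fin 3 → EuclideanSpace ℝ (Fin 3) := fun j => EuclideanSpace.single j (1 : ℝ) with he
  have hen : ∀ j, ‖e j‖ = 1 := fun j => by simp [he]
  -- ## the fields `f_j = Z_j Z` and their derivatives
  set f : Fin 3 → EuclideanSpace ℝ (Fin 3) → EuclideanSpace ℝ (Fin 3) := fun j y => (Z y j) • Z y with hf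
  set f' : Fin 3 → EuclideanSpace ℝ (Fin 3) → (EuclideanSpace ℝ (Fin 3) →L[ℝ] EuclideanSpace ℝ (Fin 3)) :=
    fun j y => (Z y j) • fderiv ℝ Z y +
      (((PiLp.proj 2 (fun _ : Fin 3 => ℝ) j : EuclideanSpace ℝ (Fin 3) →L[ℝ] ℝ).comp (fderiv ℝ Z y))).smulRight (Z y)
    with hf'
  have hff' : ∀ j y, HasFDerivAt (f j) (f' j y) y := by
    intro j y
    have hP := (PiLp.proj 2 (fun _ : Fin 3 => ℝ) j : EuclideanSpace ℝ (Fin 3) →L[ℝ] ℝ).hasFDerivAt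
      (x := Z y)
    have hc := hP.comp y (hZd y).hasFDerivAt
    exact hc.smul (hZd y).hasFDerivAt
  have hf'apply : ∀ j y v, f' j y v = (Z y j) • fderiv ℝ Z y v + (fderiv ℝ Z y v j) • Z y := by
    intro j y v
    simp [hf']
  -- `Σ_j f_j' e_j = (div Z) Z + DZ[Z] = DZ[Z]`
  have hsumf' : ∀ y, f' 0 y (e 0) + f' 1 y (e 1) + f' 2 y (e 2) = fderiv ℝ Z y (Z y) := by
    intro y
    have hd := hdiv y
    rw [divergence_eq_three] at hd
    rw [hf'apply, hf'apply, hf'apply]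
    have hZy := eq_sum_single (Z y)
    have hsplit : fderiv ℝ Z y (Z y) = (Z y 0) • fderiv ℝ Z y (e 0) + (Z y 1) • fderiv ℝ Z y (e 1) +
        (Z y 2) • fderiv ℝ Z y (e 2) := by
      conv_lhs => rw [hZy]
      simp only [map_add, map_smul, he]
    rw [hsplit]
    have hzero : (fderiv ℝ Z y (e 0) 0) • Z y + (fderiv ℝ Z y (e 1) 1) • Z y + (fderiv ℝ Z y (e 2) 2) • Z y = 0 := by
      rw [← add_smul, ← add_smul, he]
      simp only at hd ⊢
      rw [hd, zero_smul]
    calc (Z y 0) • fderiv ℝ Z y (e 0) + (fderiv ℝ Z y (e 0) 0) • Z y +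
          ((Z y 1) • fderiv ℝ Z y (e 1) + (fderiv ℝ Z y (e 1) 1) • Z y) +
          ((Z y 2) • fderiv ℝ Z y (e 2) + (fderiv ℝ Z y (e 2) 2) • Z y)
        = ((Z y 0) • fderiv ℝ Z y (e 0) + (Z y 1) • fderiv ℝ Z y (e 1) + (Z y 2) • fderiv ℝ Z y (e 2)) +
          ((fderiv ℝ Z y (e 0) 0) • Z y + (fderiv ℝ Z y (e 1) 1) • Z y + (fderiv ℝ Z y (e 2) 2) • Z y) := by
          abel
      _ = _ := by rw [hzero, add_zero]
  -- ## continuity helpers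
  have hZj_c : ∀ j : Fin 3, Continuous fun y => Z y j := fun j =>
    (PiLp.proj 2 (fun _ : Fin 3 => ℝ) j : EuclideanSpace ℝ (Fin 3) →L[ℝ] ℝ).continuous.comp hZc
  have hψj_c : ∀ j : Fin 3, Continuous fun y => ψ y j := fun j =>
    (PiLp.proj 2 (fun _ : Fin 3 => ℝ) j : EuclideanSpace ℝ (Fin 3) →L[ℝ] ℝ).continuous.comp hψc
  have hf_c : ∀ j, Continuous (f j) := fun j => (hZj_c j).smul hZc
  have hDZv_c : ∀ v : EuclideanSpace ℝ (Fin 3), Continuous fun y => fderiv ℝ Z y v := fun v =>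
    hDZc.clm_apply continuous_const
  have hDψv_c : ∀ v : EuclideanSpace ℝ (Fin 3), Continuous fun y => fderiv ℝ ψ y v := fun v =>
    hDψc.clm_apply continuous_const
  have hDψvj_c : ∀ (v : EuclideanSpace ℝ (Fin 3)) (j : Fin 3), Continuous fun y => fderiv ℝ ψ y v j :=
    fun v j => (PiLp.proj 2 (fun _ : Fin 3 => ℝ) j : EuclideanSpace ℝ (Fin 3) →L[ℝ] ℝ).continuous.comp
      (hDψv_c v)
  have hf'_c : ∀ (j : Fin 3) (v : EuclideanSpace ℝ (Fin 3)), Continuous fun y => f' j y v := by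
    intro j v
    have e1 : (fun y => f' j y v) = fun y => (Z y j) • fderiv ℝ Z y v + (fderiv ℝ Z y v j) • Z y :=
      funext fun y => hf'apply j y v
    rw [e1]
    exact ((hZj_c j).smul (hDZv_c v)).add
      (((PiLp.proj 2 (fun _ : Fin 3 => ℝ) j : EuclideanSpace ℝ (Fin 3) →L[ℝ] ℝ).continuous.comp
        (hDZv_c v)).smul hZc)
  have hG_c : Continuous fun y => fderiv ℝ Z y (Z y) := hDZc.clm_apply hZc
  -- ## pointwise bounds
  have hZj : ∀ (j : Fin 3) y, |Z y j| ≤ M := fun j y =>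
    ((Real.norm_eq_abs _).symm.le.trans (PiLp.norm_apply_le (Z y) j)).trans (hM y)
  have hfb : ∀ (j : Fin 3) y, ‖f j y‖ ≤ M * M := fun j y => by
    simp only [hf]
    rw [norm_smul, Real.norm_eq_abs]
    exact mul_le_mul (hZj j y) (hM y) (norm_nonneg _) hM0
  have hDZe : ∀ (j : Fin 3) y, ‖fderiv ℝ Z y (e j)‖ ≤ L := fun j y =>
    ((fderiv ℝ Z y).le_opNorm (e j)).trans (by rw [hen, mul_one]; exact hL y)
  have hf'b : ∀ (j : Fin 3) y, ‖f' j y (e j)‖ ≤ 2 * M * L := fun j y => by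
    rw [hf'apply]
    refine (norm_add_le _ _).trans ?_
    rw [norm_smul, norm_smul, Real.norm_eq_abs, Real.norm_eq_abs]
    have h1 : |Z y j| * ‖fderiv ℝ Z y (e j)‖ ≤ M * L :=
      mul_le_mul (hZj j y) (hDZe j y) (norm_nonneg _) hM0
    have h2 : |fderiv ℝ Z y (e j) j| * ‖Z y‖ ≤ L * M :=
      mul_le_mul (((Real.norm_eq_abs _).symm.le.trans (PiLp.norm_apply_le _ j)).trans (hDZe j y))
        (hM y) (norm_nonneg _) hL0
    linarith
  have hGb : ∀ y, ‖fderiv ℝ Z y (Z y)‖ ≤ L * M := fun y =>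
    ((fderiv ℝ Z y).le_opNorm (Z y)).trans (mul_le_mul (hL y) (hM y) (norm_nonneg _) hL0)
  have hΦ' : ∀ y (v : EuclideanSpace ℝ (Fin 3)), |(-(innerSL ℝ (fderiv ℝ Z y (Z y)))) v| ≤ L * M * ‖v‖ := by
    intro y v
    rw [neg_apply, coe_innerSL_apply, abs_neg]
    exact (abs_real_inner_le_norm _ _).trans (mul_le_mul_of_nonneg_right (hGb y) (norm_nonneg _))
  -- ## integrability of the six kinds of integrands
  have hI1 : ∀ j, Integrable fun y => ⟪f j y, fderiv ℝ ψ y (e j)⟫ := fun j => by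
    refine integrable_of_decay_four ((hf_c j).inner (hDψv_c (e j))) (C := M * M * K) fun y => ?_
    calc (1 + ‖y‖) ^ 4 * ‖⟪f j y, fderiv ℝ ψ y (e j)⟫‖
        ≤ (1 + ‖y‖) ^ 4 * (M * M * ‖fderiv ℝ ψ y‖) := by
          gcongr
          refine (norm_inner_le_norm _ _).trans ?_
          refine mul_le_mul (hfb j y) (((fderiv ℝ ψ y).le_opNorm (e j)).trans ?_) (norm_nonneg _)
            (mul_nonneg hM0 hM0)
          rw [hen, mul_one]
      _ = M * M * ((1 + ‖y‖) ^ 4 * ‖fderiv ℝ ψ y‖) := by ring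
      _ ≤ M * M * K := mul_le_mul_of_nonneg_left (hDψ4 y) (mul_nonneg hM0 hM0)
  have hI2 : ∀ j, Integrable fun y => ⟪f' j y (e j), ψ y⟫ := fun j => by
    refine integrable_of_decay_four ((hf'_c j (e j)).inner hψc) (C := 2 * M * L * K) fun y => ?_
    calc (1 + ‖y‖) ^ 4 * ‖⟪f' j y (e j), ψ y⟫‖
        ≤ (1 + ‖y‖) ^ 4 * (2 * M * L * ‖ψ y‖) := by
          gcongr
          exact (norm_inner_le_norm _ _).trans (mul_le_mul_of_nonneg_right (hf'b j y) (norm_nonneg _))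
      _ = 2 * M * L * ((1 + ‖y‖) ^ 4 * ‖ψ y‖) := by ring
      _ ≤ 2 * M * L * K := mul_le_mul_of_nonneg_left (hψ4 y) (by positivity)
  have hI3 : ∀ j, Integrable fun y => ⟪f j y, ψ y⟫ := fun j => by
    refine integrable_of_decay_four ((hf_c j).inner hψc) (C := M * M * K) fun y => ?_
    calc (1 + ‖y‖) ^ 4 * ‖⟪f j y, ψ y⟫‖
        ≤ (1 + ‖y‖) ^ 4 * (M * M * ‖ψ y‖) := by
          gcongr
          exact (norm_inner_le_norm _ _).trans (mul_le_mul_of_nonneg_right (hfb j y) (norm_nonneg _))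
      _ = M * M * ((1 + ‖y‖) ^ 4 * ‖ψ y‖) := by ring
      _ ≤ M * M * K := mul_le_mul_of_nonneg_left (hψ4 y) (mul_nonneg hM0 hM0)
  have hdΦ_c : ∀ v : EuclideanSpace ℝ (Fin 3), Continuous fun y => (-(innerSL ℝ (fderiv ℝ Z y (Z y)))) v := by
    intro v
    have e1 : (fun y => (-(innerSL ℝ (fderiv ℝ Z y (Z y)))) v) = fun y => -⟪fderiv ℝ Z y (Z y), v⟫ := by
      funext y; rw [neg_apply, coe_innerSL_apply]
    rw [e1]
    exact (hG_c.inner continuous_const).neg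
  have hI4 : ∀ j, Integrable fun y => (ψ y j) * ((-(innerSL ℝ (fderiv ℝ Z y (Z y)))) (e j)) := fun j => by
    refine integrable_of_decay_four ((hψj_c j).mul (hdΦ_c (e j))) (C := L * M * K) fun y => ?_
    calc (1 + ‖y‖) ^ 4 * ‖(ψ y j) * ((-(innerSL ℝ (fderiv ℝ Z y (Z y)))) (e j))‖
        ≤ (1 + ‖y‖) ^ 4 * (‖ψ y‖ * (L * M)) := by
          gcongr
          rw [norm_mul, Real.norm_eq_abs, Real.norm_eq_abs]
          refine mul_le_mul (((Real.norm_eq_abs _).symm.le.trans (PiLp.norm_apply_le _ j))) ?_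
            (abs_nonneg _) (norm_nonneg _)
          have := hΦ' y (e j)
          rw [hen, mul_one] at this
          exact this
      _ = L * M * ((1 + ‖y‖) ^ 4 * ‖ψ y‖) := by ring
      _ ≤ L * M * K := mul_le_mul_of_nonneg_left (hψ4 y) (mul_nonneg hL0 hM0)
  have hI5 : ∀ j, Integrable fun y => (fderiv ℝ ψ y (e j) j) * Φ y := fun j => by
    refine integrable_of_decay_four ((hDψvj_c (e j) j).mul hΦc) (C := M * L * K) fun y => ?_
    calc (1 + ‖y‖) ^ 4 * ‖(fderiv ℝ ψ y (e j) j) * Φ y‖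
        ≤ (1 + ‖y‖) ^ 4 * (‖fderiv ℝ ψ y‖ * (M * L * ‖y‖)) := by
          gcongr
          rw [norm_mul, Real.norm_eq_abs, Real.norm_eq_abs]
          refine mul_le_mul ?_ (hΦb y) (abs_nonneg _) (norm_nonneg _)
          exact (((Real.norm_eq_abs _).symm.le.trans (PiLp.norm_apply_le _ j))).trans
            (((fderiv ℝ ψ y).le_opNorm (e j)).trans (by rw [hen, mul_one]))
      _ = M * L * ((1 + ‖y‖) ^ 4 * (‖y‖ * ‖fderiv ℝ ψ y‖)) := by ring
      _ ≤ M * L * K := mul_le_mul_of_nonneg_left (hyDψ4 y) (mul_nonneg hM0 hL0)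
  have hI6 : ∀ j, Integrable fun y => (ψ y j) * Φ y := fun j => by
    refine integrable_of_decay_four ((hψj_c j).mul hΦc) (C := M * L * K) fun y => ?_
    calc (1 + ‖y‖) ^ 4 * ‖(ψ y j) * Φ y‖
        ≤ (1 + ‖y‖) ^ 4 * (‖ψ y‖ * (M * L * ‖y‖)) := by
          gcongr
          rw [norm_mul, Real.norm_eq_abs, Real.norm_eq_abs]
          exact mul_le_mul (((Real.norm_eq_abs _).symm.le.trans (PiLp.norm_apply_le _ j))) (hΦb y)
            (abs_nonneg _) (norm_nonneg _)
      _ = M * L * ((1 + ‖y‖) ^ 4 * (‖y‖ * ‖ψ y‖)) := by ring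
      _ ≤ M * L * K := mul_le_mul_of_nonneg_left (hyψ4 y) (mul_nonneg hM0 hL0)
  -- ## Step 1: `⟪Z, Dψ[Z]⟫ = Σ_j ⟪f_j, Dψ e_j⟫` pointwise
  have hexp : ∀ y, ⟪Z y, fderiv ℝ ψ y (Z y)⟫ =
      ⟪f 0 y, fderiv ℝ ψ y (e 0)⟫ + ⟪f 1 y, fderiv ℝ ψ y (e 1)⟫ + ⟪f 2 y, fderiv ℝ ψ y (e 2)⟫ := by
    intro y
    have h1 : fderiv ℝ ψ y (Z y) = (Z y 0) • fderiv ℝ ψ y (e 0) + (Z y 1) • fderiv ℝ ψ y (e 1) +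
        (Z y 2) • fderiv ℝ ψ y (e 2) := by
      conv_lhs => rw [eq_sum_single (Z y)]
      simp only [map_add, map_smul, he]
    rw [h1]
    simp only [hf, inner_add_right, real_inner_smul_right, real_inner_smul_left]
  -- ## Step 2: first integration by parts, `∫ ⟪f_j, Dψ e_j⟫ = −∫ ⟪f_j' e_j, ψ⟫`
  have hIBP1 : ∀ j, ∫ y, ⟪f j y, fderiv ℝ ψ y (e j)⟫ = -∫ y, ⟪f' j y (e j), ψ y⟫ := by
    intro j
    exact integral_bilinear_hasFDerivAt_right_eq_neg_left_of_integrable (μ := volume)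
      (B := (innerSL ℝ : EuclideanSpace ℝ (Fin 3) →L[ℝ] EuclideanSpace ℝ (Fin 3) →L[ℝ] ℝ))
      (f := f j) (f' := f' j) (g := ψ) (g' := fun y => fderiv ℝ ψ y) (v := e j)
      (hI2 j) (hI1 j) (hI3 j) (fun y _ => hff' j y) (fun y _ => (hψd y).hasFDerivAt)
  -- ## Step 3: `Σ_j ⟪f_j' e_j, ψ⟫ = ⟪DZ[Z], ψ⟫`
  have hsum3 : ∀ y, ⟪f' 0 y (e 0), ψ y⟫ + ⟪f' 1 y (e 1), ψ y⟫ + ⟪f' 2 y (e 2), ψ y⟫ =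
      ⟪fderiv ℝ Z y (Z y), ψ y⟫ := by
    intro y
    rw [← inner_add_left, ← inner_add_left, hsumf' y]
  -- ## Step 4: `⟪DZ[Z], ψ⟫ = −Σ_j ψ_j DΦ(e_j)`
  have hstep4 : ∀ y, ⟪fderiv ℝ Z y (Z y), ψ y⟫ =
      -((ψ y 0) * ((-(innerSL ℝ (fderiv ℝ Z y (Z y)))) (e 0)) +
        (ψ y 1) * ((-(innerSL ℝ (fderiv ℝ Z y (Z y)))) (e 1)) +
        (ψ y 2) * ((-(innerSL ℝ (fderiv ℝ Z y (Z y)))) (e 2))) := by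
    intro y
    simp only [neg_apply, coe_innerSL_apply]
    conv_lhs => rw [eq_sum_single (ψ y)]
    simp only [he, inner_add_right, real_inner_smul_right]
    ring
  -- ## Step 5: second integration by parts, `∫ ψ_j DΦ(e_j) = −∫ (Dψ e_j)_j Φ`
  have hIBP2 : ∀ j, ∫ y, (ψ y j) * ((-(innerSL ℝ (fderiv ℝ Z y (Z y)))) (e j)) =
      -∫ y, (fderiv ℝ ψ y (e j) j) * Φ y := by
    intro j
    have hfj : ∀ y, HasFDerivAt (fun w => ψ w j)
        ((PiLp.proj 2 (fun _ : Fin 3 => ℝ) j : EuclideanSpace ℝ (Fin 3) →L[ℝ] ℝ).comp (fderiv ℝ ψ y)) y :=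
      fun y => ((PiLp.proj 2 (fun _ : Fin 3 => ℝ) j : EuclideanSpace ℝ (Fin 3) →L[ℝ] ℝ).hasFDerivAt
        (x := ψ y)).comp y (hψd y).hasFDerivAt
    have h := integral_bilinear_hasFDerivAt_right_eq_neg_left_of_integrable (μ := volume)
      (B := ContinuousLinearMap.mul ℝ ℝ) (f := fun w => ψ w j)
      (f' := fun y => (PiLp.proj 2 (fun _ : Fin 3 => ℝ) j : EuclideanSpace ℝ (Fin 3) →L[ℝ] ℝ).comp (fderiv ℝ ψ y))
      (g := Φ) (g' := fun y => -(innerSL ℝ (fderiv ℝ Z y (Z y)))) (v := e j)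
      ?_ ?_ ?_ (fun y _ => hfj y) (fun y _ => hΦ y)
    · simpa using h
    · simpa using hI5 j
    · simpa using hI4 j
    · simpa using hI6 j
  -- ## Step 6: `Σ_j (Dψ e_j)_j = div ψ = 0`
  have hdivψ : ∀ y, fderiv ℝ ψ y (e 0) 0 + fderiv ℝ ψ y (e 1) 1 + fderiv ℝ ψ y (e 2) 2 = 0 := by
    intro y
    have h := hψdiv y
    rw [divergence_eq_three] at h
    simpa [he] using h
  -- ## assembly
  have h01 : Integrable fun y => ⟪f 0 y, fderiv ℝ ψ y (e 0)⟫ + ⟪f 1 y, fderiv ℝ ψ y (e 1)⟫ :=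
    (hI1 0).add (hI1 1)
  have h01' : Integrable fun y => ⟪f' 0 y (e 0), ψ y⟫ + ⟪f' 1 y (e 1), ψ y⟫ := (hI2 0).add (hI2 1)
  have h01'' : Integrable fun y => (ψ y 0) * ((-(innerSL ℝ (fderiv ℝ Z y (Z y)))) (e 0)) +
      (ψ y 1) * ((-(innerSL ℝ (fderiv ℝ Z y (Z y)))) (e 1)) := (hI4 0).add (hI4 1)
  have h5 : Integrable fun y => (fderiv ℝ ψ y (e 0) 0) * Φ y + (fderiv ℝ ψ y (e 1) 1) * Φ y :=
    (hI5 0).add (hI5 1)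
  have hA : ∫ y, ⟪Z y, fderiv ℝ ψ y (Z y)⟫ = -(∫ y, ⟪fderiv ℝ Z y (Z y), ψ y⟫) := by
    rw [integral_congr_ae (Eventually.of_forall hexp), integral_add h01 (hI1 2),
      integral_add (hI1 0) (hI1 1), hIBP1 0, hIBP1 1, hIBP1 2,
      ← integral_congr_ae (Eventually.of_forall hsum3), integral_add h01' (hI2 2),
      integral_add (hI2 0) (hI2 1)]
    ring
  have hB : ∫ y, ⟪fderiv ℝ Z y (Z y), ψ y⟫ =
      ((∫ y, (fderiv ℝ ψ y (e 0) 0) * Φ y) + (∫ y, (fderiv ℝ ψ y (e 1) 1) * Φ y) +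
        ∫ y, (fderiv ℝ ψ y (e 2) 2) * Φ y) := by
    rw [integral_congr_ae (Eventually.of_forall hstep4), MeasureTheory.integral_neg,
      integral_add h01'' (hI4 2), integral_add (hI4 0) (hI4 1), hIBP2 0, hIBP2 1, hIBP2 2]
    ring
  have hC : ((∫ y, (fderiv ℝ ψ y (e 0) 0) * Φ y) + (∫ y, (fderiv ℝ ψ y (e 1) 1) * Φ y) +
      ∫ y, (fderiv ℝ ψ y (e 2) 2) * Φ y) = 0 := by
    rw [← integral_add (hI5 0) (hI5 1), ← integral_add h5 (hI5 2)]
    have h0 : (fun y => fderiv ℝ ψ y (e 0) 0 * Φ y + fderiv ℝ ψ y (e 1) 1 * Φ y +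
        fderiv ℝ ψ y (e 2) 2 * Φ y) = fun _ => (0 : ℝ) := by
      funext y
      rw [← add_mul, ← add_mul, hdivψ y, zero_mul]
    rw [h0, integral_zero]
  rw [hA, hB, hC, neg_zero]

end Columnar

end Summit.NavierStokesRegularity.NavierStokesRegularity.Theorems.ScenarioCensus.PitchDefect

end
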